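import Summits.NavierStokesRegularity.NavierStokesRegularity.Theses.TypeICertificateLadder
import Literature.Analysis.FluidPDE.ClassicalSolutionCalculus
import Literature.Analysis.FluidPDE.AncientMildWeak

/-!
# `RungReynoldsOne` (stmt-NavierStokesRegularity-2882): the Leray–Hopf hypothesis is load-bearing

Negative (support) lemmas for the crux `TypeICertificateLadder.RungReynoldsOne`, extracted from the
crux work file `Cruxes/RungReynoldsOne/Disproof.lean` (cdisprove seat, gen 2): the rung statement
with `IsLerayHopfOn` dropped is false for every constant `C > 0`, by the parasitic drift
`u = g(t)driftDir`, `p = −g′(t)x₀` of Koch–Nadirashvili–Seregin–Šverák (Acta Math. 203 (2009), §1,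
arXiv:0709.3599 p. 3). [cite: KochNadirashviliSereginSverak2009, §1 p. 3 (parasitic solutions)]
-/

noncomputable section

namespace Summit.NavierStokesRegularity.NavierStokesRegularity.Theorems.RungReynoldsOneNegative

open Set Filter Topology MeasureTheory Function
open scoped InnerProductSpace RealInnerProductSpace ContDiff Laplacian ENNReal
open Literature.Analysis.FluidPDE

local notation "ℝ³" => EuclideanSpace ℝ (Fin 3)

/-! ## The witness family: pressure-driven spatially constant flows `u = g(t) driftDir`, `p = −g′(t) x₀` -/

/-- The drift direction `driftDir = (1, 0, 0)`. -/
def driftDir : ℝ³ := EuclideanSpace.single 0 1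

/-- `‖driftDir‖ = 1`. [folklore] -/
@[simp] theorem norm_driftDir : ‖driftDir‖ = 1 := by
  simp [driftDir]

/-- `driftDir ≠ 0`. [folklore] -/
theorem driftDir_ne_zero : driftDir ≠ 0 := by
  intro h
  have := norm_driftDir
  rw [h, norm_zero] at this
  exact zero_ne_one this

/-- The drift velocity `u(t, x) = g(t) driftDir` (spatially constant; zero vorticity). -/
def drift (g : ℝ → ℝ) : ℝ → ℝ³ → ℝ³ := fun t _ => g t • driftDir

/-- The drift pressure `p(t, x) = ⟪−g′(t) driftDir, x⟫ = −g′(t) x₀` (linear in `x`). -/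
def driftP (g : ℝ → ℝ) : ℝ → ℝ³ → ℝ := fun t x => ⟪-(deriv g t • driftDir), x⟫_ℝ

/-- Slices of a drift are constant fields. [folklore] -/
theorem drift_apply (g : ℝ → ℝ) (t : ℝ) : drift g t = fun _ => g t • driftDir := rfl

/-- A drift with `g 0 = 0` starts from the zero datum. [folklore] -/
theorem drift_zero {g : ℝ → ℝ} (h0 : g 0 = 0) : drift g 0 = 0 := by
  funext x
  simp [drift, h0]

/-- `‖u(t,x)‖ = |g t|` for a drift. [folklore] -/
theorem norm_drift (g : ℝ → ℝ) (t : ℝ) (x : ℝ³) : ‖drift g t x‖ = |g t| := by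
  simp [drift, norm_smul]

/-- The gradient of the linear functional `y ↦ ⟪v, y⟫` is `v`. -/
theorem gradient_inner_left (v x : ℝ³) : gradient (fun y : ℝ³ => ⟪v, y⟫_ℝ) x = v := by
  have h : HasFDerivAt (fun y : ℝ³ => ⟪v, y⟫_ℝ) (innerSL ℝ v) x := (innerSL ℝ v).hasFDerivAt
  have hv : (InnerProductSpace.toDual ℝ ℝ³).symm (innerSL ℝ v) = v := by
    apply (InnerProductSpace.toDual ℝ ℝ³).injective
    rw [LinearIsometryEquiv.apply_symm_apply]
    ext y
    simp [InnerProductSpace.toDual_apply_apply]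
  have hg := h.hasGradientAt.gradient
  rwa [hv] at hg

section Drift

variable {g : ℝ → ℝ}

/-- **Every drift is a classical solution** of unforced Navier–Stokes on `[0,1) × ℝ³`, for every
viscosity, as soon as the amplitude is smooth on `(-∞, 1)`: `∂ₜu = g′driftDir = −∇p`,
`(u·∇)u = 0`, `Δu = 0`, `div u = 0`. -/
theorem drift_isClassical (hg : ContDiffOn ℝ ∞ g (Iio 1)) (ν : ℝ) :
    IsClassicalNSSolutionOn (Ico 0 1) ν 0 (drift g) (driftP g) where
  smooth_velocity := by
    show ContDiffOn ℝ ∞ (fun z : ℝ × ℝ³ => g z.1 • driftDir) (Ico 0 1 ×ˢ univ)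
    have h1 : ContDiffOn ℝ ∞ (fun z : ℝ × ℝ³ => g z.1) (Ico 0 1 ×ˢ univ) :=
      hg.comp contDiffOn_fst fun z hz => (mem_prod.1 hz).1.2
    exact h1.smul contDiffOn_const
  smooth_pressure := by
    show ContDiffOn ℝ ∞ (fun z : ℝ × ℝ³ => ⟪-(deriv g z.1 • driftDir), z.2⟫_ℝ) (Ico 0 1 ×ˢ univ)
    have hd' : ContDiffOn ℝ ∞ (deriv g) (Iio 1) :=
      ((contDiffOn_infty_iff_deriv_of_isOpen isOpen_Iio).1 hg).2
    have hd : ContDiffOn ℝ ∞ (fun z : ℝ × ℝ³ => deriv g z.1) (Ico 0 1 ×ˢ univ) :=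
      hd'.comp contDiffOn_fst fun z hz => (mem_prod.1 hz).1.2
    exact (hd.smul contDiffOn_const).neg.inner ℝ contDiffOn_snd
  momentum t ht x := by
    have hga : HasDerivAt g (deriv g t) t :=
      (((hg t ht.2).contDiffAt (Iio_mem_nhds ht.2)).differentiableAt (by simp)).hasDerivAt
    have hderiv : timeDerivWithin (Ico 0 1) (drift g) t x = deriv g t • driftDir := by
      simp only [timeDerivWithin_apply, drift]
      exact (hga.smul_const driftDir).hasDerivWithinAt.derivWithin (uniqueDiffOn_Ico 0 1 t ht)
    have hconv : convect (drift g t) (drift g t) x = 0 := by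
      rw [drift_apply]
      simp [convect]
    have hlap : (Δ (drift g t)) x = 0 := by
      rw [drift_apply]
      simp
    have hgrad : gradient (driftP g t) x = -(deriv g t • driftDir) := by
      show gradient (fun y : ℝ³ => ⟪-(deriv g t • driftDir), y⟫_ℝ) x = _
      exact gradient_inner_left _ _
    rw [hderiv, hconv, hlap, hgrad]
    simp
  divFree t _ x := by
    rw [drift_apply]
    simp [VectorCalculus.divergence]

/-- A drift with `g(0) = 0` starts from the datum `0`, which is rapidly decaying. -/
theorem drift_rapidDecay (h0 : g 0 = 0) : HasRapidSpatialDecay (drift g 0) := by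
  rw [drift_zero h0]
  intro n K
  refine ⟨0, fun x => ?_⟩
  have h : (0 : ℝ³ → ℝ³) = fun _ => (0 : ℝ³) := rfl
  rw [h, iteratedFDeriv_fun_zero]
  simp

/-- **A drift with unbounded amplitude has no classical extension past `T = 1`**: a classical
`u'` on `[0, T') × ℝ³`, `T' > 1`, agreeing with `u` on `[0, 1)` is continuous at `(1, 0)`,
while `‖u(t, 0)‖ = |g(t)| → ∞`. -/
theorem drift_not_hasSmoothExtensionPast (hlim : Tendsto (fun t => |g t|) (𝓝[<] (1 : ℝ)) atTop)
    (ν : ℝ) : ¬ HasSmoothExtensionPast ν 0 (drift g) 1 := by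
  rintro ⟨T', hT', u', p', hcl, hagree⟩
  set F : Filter ℝ := 𝓝[Ico 0 1] (1 : ℝ) with hF
  haveI : F.NeBot := by
    refine mem_closure_iff_nhdsWithin_neBot.1 ?_
    rw [closure_Ico zero_ne_one]
    exact right_mem_Icc.2 zero_le_one
  have hcont : ContinuousWithinAt (uncurry u') (Ico 0 T' ×ˢ univ) ((1 : ℝ), (0 : ℝ³)) :=
    (hcl.smooth_velocity ((1 : ℝ), (0 : ℝ³)) ⟨⟨zero_le_one, hT'⟩, mem_univ _⟩).continuousWithinAt
  have hmap : Tendsto (fun t : ℝ => ((t, (0 : ℝ³)) : ℝ × ℝ³)) F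
      (𝓝[Ico 0 T' ×ˢ univ] ((1 : ℝ), (0 : ℝ³))) := by
    refine tendsto_nhdsWithin_iff.2 ⟨?_, ?_⟩
    · have hc : Continuous (fun t : ℝ => ((t, (0 : ℝ³)) : ℝ × ℝ³)) :=
        continuous_id.prodMk continuous_const
      exact (hc.tendsto 1).mono_left nhdsWithin_le_nhds
    · filter_upwards [self_mem_nhdsWithin] with t ht
      exact mk_mem_prod ⟨ht.1, ht.2.trans hT'⟩ (mem_univ _)
  have hlim1 : Tendsto (fun t : ℝ => uncurry u' (t, 0)) F (𝓝 (u' 1 0)) := hcont.tendsto.comp hmap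
  have hlim2 : Tendsto (fun t : ℝ => g t • driftDir) F (𝓝 (u' 1 0)) := by
    refine hlim1.congr' ?_
    filter_upwards [self_mem_nhdsWithin] with t ht
    simp [uncurry, hagree t ht, drift]
  have hnorm : Tendsto (fun t : ℝ => |g t|) F (𝓝 ‖u' 1 0‖) := by
    simpa [norm_smul] using hlim2.norm
  have hF_le : F ≤ 𝓝[<] (1 : ℝ) := nhdsWithin_mono _ fun t ht => ht.2
  exact not_tendsto_atTop_of_tendsto_nhds hnorm (hlim.mono_left hF_le)

/-- **Every locally-square-integrable drift is a weak (pressure-free) solution up to `T = 1`**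
(`IsWeakNSSolutionOn 1 ν 0 (u 0) u`), although it is classical only on `[0, 1)`: a test field
supported in `t < 1` is supported in `t ≤ b` for some `b < 1`, where the drift is classical on
the closed slab `[0, T']`, `b < T' < 1`, hence weak there (tree theorem
`IsClassicalNSSolutionOn.isWeakNSSolutionOn_holds`); the identity over `(0, 1)` is the identity
over `(0, T')` because the integrand vanishes for `t > b`. The only extra input at `T = 1` is the
local square integrability `∫₀¹ g² < ∞`. -/
theorem drift_isWeakNSSolutionOn (hg : ContDiffOn ℝ ∞ g (Iio 1))
    (hint : IntegrableOn (fun t => g t ^ 2) (Ioo 0 1)) (ν : ℝ) :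
    IsWeakNSSolutionOn 1 ν 0 (drift g 0) (drift g) := by
  have hcl := drift_isClassical hg ν
  refine ⟨?_, ?_, ?_, ?_⟩
  · -- joint measurability on `(0, 1) × ℝ³`
    have hc : ContinuousOn (uncurry (drift g)) (Ioo 0 1 ×ˢ univ) := by
      show ContinuousOn (fun z : ℝ × ℝ³ => g z.1 • driftDir) (Ioo 0 1 ×ˢ univ)
      have h1 : ContinuousOn (fun z : ℝ × ℝ³ => g z.1) (Ioo 0 1 ×ˢ univ) :=
        hg.continuousOn.comp continuousOn_fst fun z hz => (mem_prod.1 hz).1.2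
      exact h1.smul continuousOn_const
    exact hc.aestronglyMeasurable (measurableSet_Ioo.prod MeasurableSet.univ)
  · -- local square integrability up to `t = 1`
    intro K hK
    have hgm : AEMeasurable (fun t => ‖g t‖ₑ ^ 2) ((volume : Measure ℝ).restrict (Ioo 0 1)) := by
      have : AEStronglyMeasurable g ((volume : Measure ℝ).restrict (Ioo 0 1)) :=
        (hg.continuousOn.mono Ioo_subset_Iio_self).aestronglyMeasurable measurableSet_Ioo
      exact (this.aemeasurable.enorm.pow_const 2)
    have h1 : ∫⁻ t in Ioo (0 : ℝ) 1, ‖g t‖ₑ ^ 2 < ⊤ := by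
      have h := hint.hasFiniteIntegral
      rw [hasFiniteIntegral_iff_enorm] at h
      refine lt_of_le_of_lt (le_of_eq (lintegral_congr fun t => ?_)) h
      rw [enorm_pow]
    have heq : ∀ z : ℝ × ℝ³, ‖uncurry (drift g) z‖ₑ ^ 2 =
        (fun t => ‖g t‖ₑ ^ 2) z.1 * (fun _ : ℝ³ => (1 : ℝ≥0∞)) z.2 := by
      intro z
      have hn : ‖uncurry (drift g) z‖ = ‖g z.1‖ := by
        simp [uncurry, drift, norm_smul]
      rw [mul_one, ← ofReal_norm, hn, ofReal_norm]
    simp_rw [heq]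
    rw [Measure.volume_eq_prod, ← Measure.prod_restrict,
      lintegral_prod_mul hgm aemeasurable_const, lintegral_one, Measure.restrict_apply_univ]
    exact ENNReal.mul_lt_top h1 hK.measure_lt_top
  · -- weak divergence-freeness of the (constant) slices
    refine ae_of_all _ fun t => ?_
    have hd : VectorCalculus.IsDivFree (drift g t) := fun x => by
      rw [drift_apply]
      simp [VectorCalculus.divergence]
    have hc : ContDiff ℝ 1 (drift g t) := by
      rw [drift_apply]
      exact contDiff_const
    exact VectorCalculus.IsDivFree.isWeaklyDivFree_holds hd hc
  · -- the weak identity for tests supported in `t < 1`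
    intro ψ hψ hdiv
    obtain ⟨a, b, _, hb1, hψ0⟩ := hψ.exists_time_support_lt
    set T' : ℝ := (max b 0 + 1) / 2 with hT'
    have hbT' : b < T' := by
      have := le_max_left b 0
      rw [hT']; linarith
    have hT'0 : 0 < T' := by
      have := le_max_right b 0
      rw [hT']; linarith
    have hT'1 : T' < 1 := by
      have : max b 0 < 1 := max_lt hb1 one_pos
      rw [hT']; linarith
    -- the drift is weak on `[0, T')`
    have hW : IsWeakNSSolutionOn T' ν 0 (drift g 0) (drift g) :=
      IsClassicalNSSolutionOn.isWeakNSSolutionOn_holds hcl fun t ht => ⟨ht.1, ht.2.trans_lt hT'1⟩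
    -- `ψ` is a test field on the smaller slab
    have hψ' : IsSpaceTimeTestOn (slab ℝ³ (Iio T') isOpen_Iio) ψ := by
      refine ⟨hψ.contDiff, hψ.hasCompactSupport, ?_⟩
      have hsupp : support (uncurry ψ) ⊆ Iic b ×ˢ univ := by
        intro z hz
        refine mk_mem_prod ?_ (mem_univ _)
        by_contra hzb
        apply hz
        have : ψ z.1 = 0 := hψ0 z.1 fun h => hzb h.2
        show ψ z.1 z.2 = 0
        rw [this]; rfl
      have hcl' : IsClosed (Iic b ×ˢ (univ : Set ℝ³)) := isClosed_Iic.prod isClosed_univ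
      intro z hz
      have hz' := (closure_minimal hsupp hcl') hz
      show z ∈ Iio T' ×ˢ (univ : Set ℝ³)
      exact mk_mem_prod (lt_of_le_of_lt (mem_prod.1 hz').1 hbT') (mem_univ _)
    have hid := hW.2.2.2 ψ hψ' hdiv
    -- the slice integrand vanishes for `t > b`
    have hvan : ∀ t, b < t → (∫ x, (⟪drift g t x, timeDeriv ψ t x⟫ +
        ⟪drift g t x, convect (drift g t) (ψ t) x⟫ + ν * ⟪drift g t x, Δ (ψ t) x⟫ +
        ⟪(0 : ℝ → ℝ³ → ℝ³) t x, ψ t x⟫)) = 0 := by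
      intro t hbt
      have hψt : ψ t = fun _ => (0 : ℝ³) := hψ0 t fun h => (not_le.2 hbt) h.2
      have htd : ∀ x, deriv (fun s => ψ s x) t = 0 := fun x => by
        have hev : (fun s => ψ s x) =ᶠ[𝓝 t] fun _ => (0 : ℝ³) := by
          filter_upwards [Ioi_mem_nhds hbt] with s hs
          rw [hψ0 s fun h => (not_le.2 hs) h.2]
          rfl
        rw [hev.deriv_eq, deriv_const]
      simp [htd, hψt, convect]
    have hI : (∫ t in Ioo (0 : ℝ) 1, ∫ x, (⟪drift g t x, timeDeriv ψ t x⟫ +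
        ⟪drift g t x, convect (drift g t) (ψ t) x⟫ + ν * ⟪drift g t x, Δ (ψ t) x⟫ +
        ⟪(0 : ℝ → ℝ³ → ℝ³) t x, ψ t x⟫)) =
        ∫ t in Ioo (0 : ℝ) T', ∫ x, (⟪drift g t x, timeDeriv ψ t x⟫ +
        ⟪drift g t x, convect (drift g t) (ψ t) x⟫ + ν * ⟪drift g t x, Δ (ψ t) x⟫ +
        ⟪(0 : ℝ → ℝ³ → ℝ³) t x, ψ t x⟫) := by
      refine setIntegral_eq_of_subset_of_forall_sdiff_eq_zero measurableSet_Ioo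
        (Ioo_subset_Ioo le_rfl hT'1.le) fun t ht => hvan t ?_
      have h1 : ¬ t < T' := fun h => ht.2 ⟨ht.1.1, h⟩
      exact hbT'.trans_le (not_lt.1 h1)
    rw [hI]
    exact hid

end Drift

/-! ## (a) Load-bearing analysis I: finite energy dropped — Type-I rate attained exactly -/

/-- The Type-I amplitude `g_C(t) = C((1−t)^{-1/2} − 1)`: smooth on `(-∞, 1)`, `g_C(0) = 0`,
`√(1−t) g_C(t) = C(1 − √(1−t)) ∈ [0, C]` on `[0, 1)`, `g_C(t) → +∞` as `t ↑ 1` (`C > 0`). -/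
def gI (C : ℝ) (t : ℝ) : ℝ := C * ((Real.sqrt (1 - t))⁻¹ - 1)

/-- `g_C(0) = 0`. [folklore] -/
theorem gI_zero (C : ℝ) : gI C 0 = 0 := by simp [gI]

/-- `s ↦ √(1−s)` is smooth at `t < 1`. [folklore] -/
theorem sqrt_one_sub_contDiffAt {t : ℝ} (ht : t < 1) :
    ContDiffAt ℝ ∞ (fun s : ℝ => Real.sqrt (1 - s)) t :=
  (Real.contDiffAt_sqrt (sub_pos.2 ht).ne').comp t (contDiffAt_const.sub contDiffAt_id)

/-- `g_C` is smooth on `(-∞, 1)`. [folklore] -/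
theorem gI_contDiffOn (C : ℝ) : ContDiffOn ℝ ∞ (gI C) (Iio 1) := by
  intro t ht
  have h2 : ContDiffAt ℝ ∞ (fun s : ℝ => (Real.sqrt (1 - s))⁻¹) t :=
    (sqrt_one_sub_contDiffAt ht).inv (Real.sqrt_pos.2 (sub_pos.2 ht)).ne'
  exact (contDiffAt_const.mul (h2.sub contDiffAt_const)).contDiffWithinAt

/-- `√(1−t) · g_C(t) = C (1 − √(1−t))` for `t < 1`. -/
theorem sqrt_mul_gI (C : ℝ) {t : ℝ} (ht : t < 1) :
    Real.sqrt (1 - t) * gI C t = C * (1 - Real.sqrt (1 - t)) := by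
  have hs : Real.sqrt (1 - t) ≠ 0 := (Real.sqrt_pos.2 (sub_pos.2 ht)).ne'
  unfold gI
  field_simp

/-- `√(1−t) ≤ 1` for `t ≥ 0`. [folklore] -/
theorem sqrt_one_sub_le_one {t : ℝ} (ht0 : 0 ≤ t) : Real.sqrt (1 - t) ≤ 1 :=
  calc Real.sqrt (1 - t) ≤ Real.sqrt 1 := Real.sqrt_le_sqrt (by linarith)
    _ = 1 := Real.sqrt_one

/-- `g_C ≥ 0` on `[0,1)` for `C ≥ 0`. [folklore] -/
theorem gI_nonneg (C : ℝ) (hC : 0 ≤ C) {t : ℝ} (ht0 : 0 ≤ t) (ht : t < 1) : 0 ≤ gI C t := by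
  unfold gI
  refine mul_nonneg hC (sub_nonneg.2 ?_)
  exact (one_le_inv₀ (Real.sqrt_pos.2 (sub_pos.2 ht))).2 (sqrt_one_sub_le_one ht0)

/-- The collapse Reynolds number of the Type-I drift: `√(1−t) ‖u(t,x)‖ ≤ C = C √1` on `[0,1)`. -/
theorem driftI_rate (C : ℝ) (hC : 0 ≤ C) :
    ∀ᶠ t in 𝓝[<] (1 : ℝ), ∀ x : ℝ³,
      Real.sqrt (1 - t) * ‖drift (gI C) t x‖ ≤ C * Real.sqrt 1 := by
  filter_upwards [Ioo_mem_nhdsLT (zero_lt_one' ℝ)] with t ht x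
  have hg : 0 ≤ gI C t := gI_nonneg C hC ht.1.le ht.2
  have hs1 := sqrt_one_sub_le_one ht.1.le
  have hs0 : 0 ≤ Real.sqrt (1 - t) := Real.sqrt_nonneg _
  rw [norm_drift, abs_of_nonneg hg, Real.sqrt_one, sqrt_mul_gI C ht.2]
  nlinarith

/-- `1 − t → 0⁺` as `t ↑ 1`. -/
theorem tendsto_one_sub_nhdsLT :
    Tendsto (fun t : ℝ => 1 - t) (𝓝[<] (1 : ℝ)) (𝓝[>] (0 : ℝ)) := by
  refine tendsto_nhdsWithin_iff.2 ⟨?_, ?_⟩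
  · have : Tendsto (fun t : ℝ => 1 - t) (𝓝 (1 : ℝ)) (𝓝 (1 - 1)) :=
      (continuous_const.sub continuous_id).tendsto 1
    simpa using this.mono_left nhdsWithin_le_nhds
  · filter_upwards [self_mem_nhdsWithin] with t ht
    exact sub_pos.2 (show t < 1 from ht)

/-- `√x → 0⁺` as `x → 0⁺`. -/
theorem tendsto_sqrt_nhdsGT : Tendsto Real.sqrt (𝓝[>] (0 : ℝ)) (𝓝[>] (0 : ℝ)) := by
  have h := Real.continuous_sqrt.continuousWithinAt.tendsto_nhdsWithin
    (s := Ioi (0 : ℝ)) (t := Ioi (0 : ℝ)) (x := 0) (fun x hx => Real.sqrt_pos.2 hx)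
  simpa using h

/-- `g_C(t) → +∞` as `t ↑ 1` (`C > 0`). -/
theorem tendsto_gI_atTop (C : ℝ) (hC : 0 < C) : Tendsto (gI C) (𝓝[<] (1 : ℝ)) atTop := by
  have h3 : Tendsto (fun t : ℝ => (Real.sqrt (1 - t))⁻¹) (𝓝[<] (1 : ℝ)) atTop :=
    tendsto_inv_nhdsGT_zero.comp (tendsto_sqrt_nhdsGT.comp tendsto_one_sub_nhdsLT)
  have h4 : Tendsto (fun t : ℝ => (Real.sqrt (1 - t))⁻¹ + (-1)) (𝓝[<] (1 : ℝ)) atTop :=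
    tendsto_atTop_add_const_right _ _ h3
  refine (h4.const_mul_atTop hC).congr' (Eventually.of_forall fun t => ?_)
  simp [gI, sub_eq_add_neg]

/-- `|g_C| → ∞` as `t ↑ 1`. [folklore] -/
theorem tendsto_abs_gI_atTop (C : ℝ) (hC : 0 < C) :
    Tendsto (fun t => |gI C t|) (𝓝[<] (1 : ℝ)) atTop :=
  tendsto_abs_atTop_atTop.comp (tendsto_gI_atTop C hC)

/-- **Load-bearing (finite energy), all rungs.** For every `C > 0` the rung `X_C` with the
Leray–Hopf hypothesis dropped is FALSE: the Type-I drift `u = g_C(t)driftDir`, `p = −g_C′(t)x₀`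
(`ν = T = 1`) is classical on `[0,1) × ℝ³` from the datum `0`, has collapse Reynolds number
`≤ C` on all of `[0,1)`, zero vorticity, and no classical extension past `1`. Hence any proof of
any rung — of `RungZero` as much as of the crux — must use the energy class (classically: at the
step "singular time ⇒ a norm of `ω`/a local scale-invariant quantity blows up", e.g. the
Leray–Giga lower `L^r` rate in the `L^q`-vorticity budget line). [folklore: the `L^∞`
non-uniqueness example `u = g(t)`, `p = −g′·x`] -/
theorem rungReynoldsOne_rung_false_without_LerayHopf (C : ℝ) (hC : 0 < C) :
    ¬ (∀ (ν T : ℝ), 0 < ν → 0 < T → ∀ (u : ℝ → ℝ³ → ℝ³) (p : ℝ → ℝ³ → ℝ),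
      IsClassicalNSSolutionOn (Set.Ico 0 T) ν 0 u p →
      HasRapidSpatialDecay (u 0) →
      (∀ᶠ t in 𝓝[<] T, ∀ x, Real.sqrt (T - t) * ‖u t x‖ ≤ C * Real.sqrt ν) →
      HasSmoothExtensionPast ν 0 u T) := by
  intro h
  exact drift_not_hasSmoothExtensionPast (tendsto_abs_gI_atTop C hC) 1
    (h 1 1 one_pos one_pos (drift (gI C)) (driftP (gI C)) (drift_isClassical (gI_contDiffOn C) 1)
      (drift_rapidDecay (gI_zero C)) (driftI_rate C hC.le))

/-- **Load-bearing (finite energy), the crux verbatim.** `RungReynoldsOne` with the hypothesis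
`IsLerayHopfOn T ν 0 (u 0) u` deleted is FALSE (the Type-I drift at `C = 1`). -/
theorem rungReynoldsOne_false_without_LerayHopf :
    ¬ (∀ (ν T : ℝ), 0 < ν → 0 < T → ∀ (u : ℝ → ℝ³ → ℝ³) (p : ℝ → ℝ³ → ℝ),
      IsClassicalNSSolutionOn (Set.Ico 0 T) ν 0 u p →
      HasRapidSpatialDecay (u 0) →
      (∀ᶠ t in 𝓝[<] T, ∀ x, Real.sqrt (T - t) * ‖u t x‖ ≤ Real.sqrt ν) →
      HasSmoothExtensionPast ν 0 u T) := by
  intro h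
  refine drift_not_hasSmoothExtensionPast (tendsto_abs_gI_atTop 1 one_pos) 1
    (h 1 1 one_pos one_pos (drift (gI 1)) (driftP (gI 1)) (drift_isClassical (gI_contDiffOn 1) 1)
      (drift_rapidDecay (gI_zero 1)) ?_)
  simpa using driftI_rate 1 zero_le_one


end Summit.NavierStokesRegularity.NavierStokesRegularity.Theorems.RungReynoldsOneNegative

end
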